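/-
Copyright: the b2b-balaban T⁴-continuum CRUX team, row NE7b leaf lineage `t4-ne7b-formalise-leaf-05` (gen 152). Project licence.
-/
import Literature.MathematicalPhysics.QuantumFieldTheory.Balaban1983to89.B9Thm311LaplaceAkPositiveDiagonal
import Mathlib.Analysis.InnerProductSpace.PiL2
import Mathlib.LinearAlgebra.Complex.FiniteDimensional

/-!
# THE FIBRE FLOOR BY NAME FOR BAŁABAN's BACKGROUND-FIELD OPERATOR: at every small background field `U` (print's windows (3.35)) the
# `k`-th-step operator `Δ^{(k)}_a(U) = Δ(U) + D R_k(U) D* + Q_k(U)†aQ_k(U)` — the argument of the Green's function `G_k(U)` — is `γ₁`-coercive with a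
# LEVEL-FREE `γ₁` ([B9] Thm 3.11 p. 416, PROVED in the tree by the NE9 chain: `…B9Thm311LaplaceAkPositiveDiagonal`, complex-Hilbert currency), read in the
# road's REAL operator currency `σ‖v‖² ≤ ⟪v, A v⟫` on `EuclideanSpace ℝ (Fin N)` along ANY real isometric chart — the `hσ` (and, for a unitary
# background, `hA`) letter of `…ConvexTiltSuppliers` ∕ `…ConvexWindowSuppliers` ∕ `…CoerciveFluctuationFloor` §3–§4; plus (§3–§5) the ceiling and the
# two-sided covariance letters of `G_k(U)` (row NE7b, node U5c; residual (R2′) family (2), letter (ℓ1); kernel lemmas + junctions BY NAME)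

Cell `pub-balaban`, sub-cell `t4`, spine estimate NE7b (`T4WeightBudget.RelWeightBound`; the cell's OWN estimate — NOT PRINTED in [Bałaban 1983–89],
NOT PROVED).  Crux-route work under `Spine/NE7b/`; NOTHING of Bałaban's is asserted: the analytic inputs are the NE9 row's THEOREMS (net new unproved
facts there: 0), consumed BY NAME with binders VERBATIM; no `def`; zero `sorry`; no `T4Continuum/Support` leaf (FREEZE (0)).
Imports: `…B9Thm311LaplaceAkPositiveDiagonal` (built), Mathlib `InnerProductSpace.PiL2`, `LinearAlgebra.Complex.FiniteDimensional`.
WHY.  `…CoerciveFluctuationFloor` (leaf-05 g151) named this NE9 module «a third currency, not bridged here»; `…ScalarTowerFibreFloor` (g152) gave the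
floor BY VALUE for the scalar prototype at `U = 1`; THIS FILE gives it BY NAME for the background-field operator itself, at every small `U`.

WHAT IS PROVED ([folklore] transport + one junction):
* §1 INSTANCE-FREE CHART TRANSPORT complex → real (a chart = any `T : E → F` with `⟪T x, T y⟫_ℝ = re⟨x, y⟩_ℂ`, onto; `A′ (T x) = T (A x)` reads `A`):
  `norm_sq_chart`, **`coercive_chart_of_re_inner`** (the road's `hσ`), `inner_le_chart_of_re_inner_le`, **`inner_symm_chart_of_isSymmetric`** (`hA`),
  `chart_add ∕ chart_real_smul`, **`exists_chart`** (finite dimension; `stdOrthonormalBasis` after `InnerProductSpace.complexToReal`).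
* §2 **`coercive_laplaceAk_chart`** — THE JUNCTION: the binders of `exists_coercive_laplaceAk_diagonal_closed` VERBATIM (`L`, `φ : W ≃ₗ 𝔸`, `M_φ, M_φ′`,
  `a > 0`, `0 ≤ r < 1`, `τ`, `C_τ`, `ρ_w`; `∃ α₀ γ₁ > 0`, ∀ level ∕ spacing ∕ weights ∕ volume ∕ background `U` in the small-field windows, `α ≤ α₀`) ⊢ for
  EVERY chart `(T, A′)` of `(BondL2K, Δ^{(n+1)}_a(U))` into `EuclideanSpace ℝ (Fin N)`: `γ₁‖v‖² ≤ ⟪v, A′v⟫_ℝ`; **`inner_symm_laplaceAk_chart`** (unitary `U`,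
  `laplaceAk_isSymmetric`'s hypotheses verbatim): `A′` symmetric — the road's `(hσ, hA)` pair.
* §3 (v1.1) `norm_chart`, `norm_map_chart_le` (operator-norm letters transport to any chart) and **`norm_G1k_chart_le`** — the NE9 chain's
  `exists_norm_G1k_le_diagonal_closed` ([B9] Thm 3.4's `L²` clause, `‖G_k(U)y‖ ≤ γ₁⁻¹‖y‖`, level-free) read in any chart: the road's covariance
  ceiling `‖C‖ ≤ B₀` with `B₀ = γ₁⁻¹` for the `k`-th-step Green's function at every small background.
* §4 (v1.2) RECTANGULAR transport for maps between two spaces (`norm_map_chart₂_le`, `inner_map_chart₂`, **`inner_adjoint_chart₂`** — adjoint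
  pairs stay adjoint pairs —, **`exists_chart₂`**): the groundwork for reading print's `Q_k(U)`, `D`, `G_k(U)` as real matrices between charts.
* §5 (v1.3) `covariance_letters_of_re_inner ∕ _chart` (floor of `A` + `A ∘ G = id` ⟹ `‖G‖ ≤ γ⁻¹`, `0 ≤ re⟨y,Gy⟩ ≤ γ⁻¹‖y‖²`) and
  **`covariance_G1k_chart`** — the road's two-sided covariance letters `0 ≤ ⟪v, G′v⟫ ≤ γ₁⁻¹‖v‖²`, `‖G′‖ ≤ γ₁⁻¹` for `G_k(U)` with the SAME `(α₀, γ₁)` as §2.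

NOT HERE (honest): Hessian ∕ secant currencies (consumers turn `(hσ, hA)` into them); the CONSTRAINED form `C*Δ_kC` of [B9] Sect. E (`…CoerciveFluctuationFloor`
§5; G-B9-09 — its (h2), a floor of `Δ(U) + DRD*` RELATIVE to `Q†Q` on admissible fields, is NOT implied by Thm 3.11); which window ∕ chart print's step uses
((A3) ∕ (A1c), NC-NE7b-α UNRULED); the NE9 file's declared readings (plaquette window displayed separately; `ρ_w`; «on the diagonal» `c₀(L^{n+1})^d = c₁`)
carry over; no toy (the junction's data are print's lattice objects).  BY-NAME EFFECT ON THE WALL: NONE ((ℓ1)'s `λ` now has a PROVED supplier for the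
background-field operator at small fields; λ BY VALUE = `γ₁ = γ(d,a)∕4`-type closed constants of the NE9 files).  NE7b NOT PRINTED ∕ NOT PROVED;
spine PROVED 0∕9; rung (B)+1 on ONE finite T⁴ — NOT infinite volume, NOT the mass gap, NOT Clay.
HONEST DEPENDENCY: continuum YM on T⁴ ⇐ BetaPertH ∧ nine spine estimates (0/9 proved); BetaPertH ⇐ (D1) ∧ (D4) ∧ CAP+tail.
-/

set_option autoImplicit false
noncomputable section
open scoped InnerProductSpace ComplexConjugate

namespace Summit.QuantumFields.BalabanUV.T4Continuum.NE7b.BackgroundFibreFloor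

/-! ## §1 Instance-free chart transport: complex-Hilbert coercivity ⟹ the road's real operator letters -/

section Chart

variable {E : Type*} [NormedAddCommGroup E] [InnerProductSpace ℂ E]
variable {F : Type*} [NormedAddCommGroup F] [InnerProductSpace ℝ F]

/-- A chart preserves the norm: `‖T x‖² = ‖x‖²`. [folklore] -/
theorem norm_sq_chart {T : E → F} (hT : ∀ x y, ⟪T x, T y⟫_ℝ = RCLike.re ⟪x, y⟫_ℂ) (x : E) : ‖T x‖ ^ 2 = ‖x‖ ^ 2 := by
  rw [← real_inner_self_eq_norm_sq, hT, inner_self_eq_norm_sq (𝕜 := ℂ)]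

/-- A chart is additive: `T (x + y) = T x + T y` (its image spans: `‖T(x+y) − Tx − Ty‖² = 0` by expanding inner products). [folklore] -/
theorem chart_add {T : E → F} (hT : ∀ x y, ⟪T x, T y⟫_ℝ = RCLike.re ⟪x, y⟫_ℂ) (hTs : Function.Surjective T) (x y : E) :
    T (x + y) = T x + T y := by
  -- `⟪T(x+y) − Tx − Ty, T z⟫ = 0` for every `z`, and `T` is onto
  have h0 : ∀ z, ⟪T (x + y) - T x - T y, T z⟫_ℝ = 0 := fun z => by
    rw [inner_sub_left, inner_sub_left, hT, hT, hT, inner_add_left, map_add]; ring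
  have h1 : ⟪T (x + y) - T x - T y, T (x + y) - T x - T y⟫_ℝ = 0 := by
    obtain ⟨z₁, hz₁⟩ := hTs (T (x + y) - T x - T y)
    have h := h0 z₁
    rwa [hz₁] at h
  rw [real_inner_self_eq_norm_sq, sq_eq_zero_iff, norm_eq_zero, sub_sub, sub_eq_zero] at h1
  rw [h1]

/-- A chart is real-homogeneous: `T (r • x) = r • T x`. [folklore] -/
theorem chart_real_smul {T : E → F} (hT : ∀ x y, ⟪T x, T y⟫_ℝ = RCLike.re ⟪x, y⟫_ℂ) (hTs : Function.Surjective T) (r : ℝ) (x : E) :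
    T ((r : ℂ) • x) = r • T x := by
  have h0 : ∀ z, ⟪T ((r : ℂ) • x) - r • T x, T z⟫_ℝ = 0 := fun z => by
    rw [inner_sub_left, real_inner_smul_left, hT, hT, inner_smul_left, Complex.conj_ofReal]
    simp only [RCLike.re_to_complex, Complex.re_ofReal_mul, sub_self]
  have h1 : ⟪T ((r : ℂ) • x) - r • T x, T ((r : ℂ) • x) - r • T x⟫_ℝ = 0 := by
    obtain ⟨z₁, hz₁⟩ := hTs (T ((r : ℂ) • x) - r • T x)
    have h := h0 z₁
    rwa [hz₁] at h
  rw [real_inner_self_eq_norm_sq, sq_eq_zero_iff, norm_eq_zero, sub_eq_zero] at h1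
  exact h1

/-- **COMPLEX-HILBERT COERCIVITY ⟹ THE ROAD's `hσ` LETTER IN ANY CHART**: `γ‖x‖² ≤ re⟨x, Ax⟩_ℂ` for all `x`, `T` a chart onto `F`,
`A′ (T x) = T (A x)` ⊢ `γ‖v‖² ≤ ⟪v, A′v⟫_ℝ` for all `v : F`. [folklore] -/
theorem coercive_chart_of_re_inner {T : E → F} (hT : ∀ x y, ⟪T x, T y⟫_ℝ = RCLike.re ⟪x, y⟫_ℂ) (hTs : Function.Surjective T)
    {A : E → E} {A' : F → F} (hA' : ∀ x, A' (T x) = T (A x)) {γ : ℝ} (hγ : ∀ x, γ * ‖x‖ ^ 2 ≤ RCLike.re ⟪x, A x⟫_ℂ) (v : F) :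
    γ * ‖v‖ ^ 2 ≤ ⟪v, A' v⟫_ℝ := by
  obtain ⟨x, rfl⟩ := hTs v
  rw [hA', hT, norm_sq_chart hT]
  exact hγ x

/-- The CEILING transports the same way: `re⟨x, Ax⟩ ≤ Γ‖x‖²` ⊢ `⟪v, A′v⟫_ℝ ≤ Γ‖v‖²`. [folklore] -/
theorem inner_le_chart_of_re_inner_le {T : E → F} (hT : ∀ x y, ⟪T x, T y⟫_ℝ = RCLike.re ⟪x, y⟫_ℂ) (hTs : Function.Surjective T)
    {A : E → E} {A' : F → F} (hA' : ∀ x, A' (T x) = T (A x)) {Γ : ℝ} (hΓ : ∀ x, RCLike.re ⟪x, A x⟫_ℂ ≤ Γ * ‖x‖ ^ 2) (v : F) :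
    ⟪v, A' v⟫_ℝ ≤ Γ * ‖v‖ ^ 2 := by
  obtain ⟨x, rfl⟩ := hTs v
  rw [hA', hT, norm_sq_chart hT]
  exact hΓ x

/-- **SYMMETRY ⟹ THE ROAD's `hA` LETTER IN ANY CHART**: `⟨Ax, y⟩_ℂ = ⟨x, Ay⟩_ℂ` for all `x, y` ⊢ `⟪A′v, w⟫_ℝ = ⟪v, A′w⟫_ℝ`. [folklore] -/
theorem inner_symm_chart_of_isSymmetric {T : E → F} (hT : ∀ x y, ⟪T x, T y⟫_ℝ = RCLike.re ⟪x, y⟫_ℂ) (hTs : Function.Surjective T)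
    {A : E → E} {A' : F → F} (hA' : ∀ x, A' (T x) = T (A x)) (hA : ∀ x y, ⟪A x, y⟫_ℂ = ⟪x, A y⟫_ℂ) (v w : F) :
    ⟪A' v, w⟫_ℝ = ⟪v, A' w⟫_ℝ := by
  obtain ⟨x, rfl⟩ := hTs v
  obtain ⟨y, rfl⟩ := hTs w
  rw [hA', hA', hT, hT, hA]

/-- **CHARTS EXIST** (finite dimension): every finite-dimensional complex inner product space has a chart `T` onto `EuclideanSpace ℝ (Fin N)`,
`N = dim_ℝ E`, in which every `ℂ`-linear operator `A` is read by a continuous real-linear `A′` (`A′ ∘ T = T ∘ A`) — the real orthonormal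
coordinates `stdOrthonormalBasis ℝ E` of `E` viewed as a real inner product space (`InnerProductSpace.complexToReal`), `A′ = T ∘ A ∘ T⁻¹`.
So the junction of §2 is not vacuous in `(T, A′)`. [folklore] -/
theorem exists_chart [FiniteDimensional ℂ E] : ∃ (N : ℕ) (T : E → EuclideanSpace ℝ (Fin N)),
    (∀ x y, ⟪T x, T y⟫_ℝ = RCLike.re ⟪x, y⟫_ℂ) ∧ Function.Surjective T ∧
    ∀ A : E →ₗ[ℂ] E, ∃ A' : EuclideanSpace ℝ (Fin N) →L[ℝ] EuclideanSpace ℝ (Fin N), ∀ x, A' (T x) = T (A x) := by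
  letI : InnerProductSpace ℝ E := InnerProductSpace.complexToReal
  let b := stdOrthonormalBasis ℝ E
  refine ⟨Module.finrank ℝ E, b.repr, fun x y => ?_, b.repr.surjective, fun A => ?_⟩
  · rw [b.repr.inner_map_map, real_inner_eq_re_inner]
  · refine ⟨(b.repr.toContinuousLinearEquiv : E →L[ℝ] EuclideanSpace ℝ (Fin (Module.finrank ℝ E))).comp
      ((A.restrictScalars ℝ).toContinuousLinearMap.comp
        (b.repr.symm.toContinuousLinearEquiv : EuclideanSpace ℝ (Fin (Module.finrank ℝ E)) →L[ℝ] E)), fun x => ?_⟩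
    simp

end Chart

end Summit.QuantumFields.BalabanUV.T4Continuum.NE7b.BackgroundFibreFloor

/-! ## §2 THE JUNCTION BY NAME: [B9] Thm 3.11 (the NE9 chain's theorem) ⟹ the road's letters for `Δ^{(n+1)}_a(U)` at small fields -/
namespace Summit.QuantumFields.BalabanUV.T4Continuum.NE7b.BackgroundFibreFloor

open Literature.MathematicalPhysics.QuantumFieldTheory.Balaban1983to89
open Literature.MathematicalPhysics.QuantumFieldTheory.Balaban1983to89.B9Thm311LaplaceAkPositiveDiagonal
open B4Sect5Torus (TSite)
open B9SectCLatticeCarrier (Bond)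
open B11Eq103H1Complex (BondL2K)
open B9Eq310HessianOperator (adTransportW)
open B9Eq310DeltaPrime (plaqHolU)
open B9Eq315QTorus (perCfg cornerSite)
open B9Eq315QTower (towerP UlevOf)
open B9Eq326OperatorTower (laplaceAk laplaceAk_isSymmetric)
open B7Prop1Explicit (U1 Wcx boxVec)

variable {d : ℕ} (L : ℕ) [NeZero L] (hL : 1 ≤ L)
  {𝔸 : Type*} [NormedRing 𝔸] [NormedAlgebra ℂ 𝔸] [CompleteSpace 𝔸] [NormOneClass 𝔸] [StarRing 𝔸] [NormedStarGroup 𝔸] [StarModule ℂ 𝔸]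
  {W : Type*} [NormedAddCommGroup W] [InnerProductSpace ℂ W] [FiniteDimensional ℂ W] (φ : W ≃ₗ[ℂ] 𝔸)
  {Mφ Mφ' : ℝ} (hMφ : 0 ≤ Mφ) (hMφ' : 0 ≤ Mφ') (hφ : ∀ w, ‖φ w‖ ≤ Mφ * ‖w‖) (hφ' : ∀ X, ‖φ.symm X‖ ≤ Mφ' * ‖X‖)
  {a : ℝ} (ha : 0 < a) {r : ℝ} (hr0 : 0 ≤ r) (hr1 : r < 1)
  (τ : 𝔸 →ₗ[ℂ] ℂ) {Cτ : ℝ} (hτ : ∀ X, ‖τ X‖ ≤ Cτ * ‖X‖) (hCτ : 0 ≤ Cτ) {ρw : ℝ} (hρw : 0 ≤ ρw)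

include hMφ hMφ' hφ hφ' ha hr0 hr1 hτ hCτ hρw

/-- **THE ROAD's FIBRE FLOOR FOR BAŁABAN's BACKGROUND-FIELD OPERATOR, BY NAME.**  The binders of
`B9Thm311LaplaceAkPositiveDiagonal.exists_coercive_laplaceAk_diagonal_closed` VERBATIM; its conclusion `γ₁‖x‖² ≤ re⟨x, Δ^{(n+1)}_a(U)x⟩_ℂ` is read in
ANY chart `T : BondL2K ℂ d (towerP L m (n+1)) c₀ W → EuclideanSpace ℝ (Fin N)` (`⟪Tx, Ty⟫_ℝ = re⟨x, y⟩`, onto) through ANY `A′` with `A′ ∘ T = T ∘ Δ`: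
`γ₁‖v‖² ≤ ⟪v, A′v⟫_ℝ` for all `v` — the `hσ` letter of `…ConvexTiltSuppliers` ∕ `…ConvexWindowSuppliers` ∕ `…CoerciveFluctuationFloor` §3–§4, with a
LEVEL-FREE `γ₁` at every small background. [junction; the estimate is the NE9 chain's theorem ([B9] Thm 3.11 p. 416)] -/
theorem coercive_laplaceAk_chart :
    ∃ α₀ γ₁ : ℝ, 0 < α₀ ∧ 0 < γ₁ ∧ ∀ (n : ℕ) (η : ℝ), η * (L : ℝ) ^ (n + 1) = 1 →
      ∀ (c₀ c₁ : ℝ) [Fact (0 < c₀)] [Fact (0 < c₁)], c₀ * ((L : ℝ) ^ (n + 1)) ^ d = c₁ → |η| ^ d / c₀ ≤ ρw →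
      ∀ (m : Fin d → ℕ) [∀ i, NeZero (m i)] (U : Bond d (towerP L m (n + 1)) → 𝔸ˣ) (αU : ℕ → ℝ) (hα1 : ∀ j, αU j ≤ 1 / 64)
        (hU1 : ∀ (j : ℕ) (x : B7Prop1Explicit.Site d) (κ : Fin d), perCfg (towerP L m (j + 1)) (UlevOf L m (n + 1) U j) x κ ∈ U1 𝔸)
        (hreg : ∀ (j : ℕ) (y : TSite d (towerP L m j)) (κ : Fin d) (r : Fin d → Fin L),
          ‖((Wcx L (perCfg (towerP L m (j + 1)) (UlevOf L m (n + 1) U j)) (cornerSite L y) κ (boxVec L r) : 𝔸ˣ) : 𝔸) - 1‖ ≤ αU j)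
        (εU : ℕ → ℝ), (∀ j, 0 ≤ εU j) → (∀ (j : ℕ) (b : Bond d (towerP L m (j + 1))), ‖(UlevOf L m (n + 1) U j b : 𝔸) - 1‖ ≤ εU j) →
      ∀ {α : ℝ}, 0 ≤ α → α ≤ α₀ →
        (∀ (b : Bond d (towerP L m (n + 1))) (v u : W), ⟪adTransportW φ U b v, u⟫_ℂ = ⟪v, adTransportW φ (fun b => (U b)⁻¹) b u⟫_ℂ) →
        (∀ b, U b ∈ U1 𝔸) → (∀ b, ‖(U b : 𝔸) - 1‖ ≤ α * η) →
        (∀ p : B9SectCLatticeCarrier.Plaq d (towerP L m (n + 1)), ‖(plaqHolU U p : 𝔸) - 1‖ ≤ α * η ^ 2) →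
        (∀ j < n + 1, εU j ≤ α * r ^ j) →
        ∀ {N : ℕ} (T : BondL2K ℂ d (towerP L m (n + 1)) c₀ W → EuclideanSpace ℝ (Fin N)),
          (∀ x y, ⟪T x, T y⟫_ℝ = RCLike.re ⟪x, y⟫_ℂ) → Function.Surjective T →
        ∀ (A' : EuclideanSpace ℝ (Fin N) → EuclideanSpace ℝ (Fin N)),
          (∀ x, A' (T x) = T (laplaceAk L m n φ η U hL αU hα1 hU1 hreg τ (c₀ := c₀) (c₁ := c₁) a x)) →
        ∀ v : EuclideanSpace ℝ (Fin N), γ₁ * ‖v‖ ^ 2 ≤ ⟪v, A' v⟫_ℝ := by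
  obtain ⟨α₀, γ₁, hα₀, hγ₁, H⟩ := exists_coercive_laplaceAk_diagonal_closed L hL φ hMφ hMφ' hφ hφ' ha hr0 hr1 τ hτ hCτ hρw
  refine ⟨α₀, γ₁, hα₀, hγ₁, ?_⟩
  intro n η hηL c₀ c₁ _ _ hw hρ m _ U αU hα1 hU1 hreg εU hεU hUε α hα0 hαle hRS hUb hUη hpl hεg N T hT hTs A' hA' v
  exact coercive_chart_of_re_inner hT hTs hA'
    (fun x => H n η hηL c₀ c₁ hw hρ m U αU hα1 hU1 hreg εU hεU hUε hα0 hαle hRS hUb hUη hpl hεg x) v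

omit [NormedStarGroup 𝔸] hMφ hMφ' hφ hφ' ha hr0 hr1 hτ hCτ hρw in
/-- **… AND THE `hA` LETTER FOR A UNITARY BACKGROUND**: under `laplaceAk_isSymmetric`'s hypotheses VERBATIM (`U(b)* = U(b)⁻¹`, `τ` a `*`-trace,
`⟨φ⁻¹X, φ⁻¹Y⟩ = τ(X*Y)`) the chart operator `A′` of `Δ^{(n+1)}_a(U)` is symmetric: `⟪A′v, w⟫_ℝ = ⟪v, A′w⟫_ℝ`. [junction] -/
theorem inner_symm_laplaceAk_chart (n : ℕ) (η : ℝ) {c₀ c₁ : ℝ} [Fact (0 < c₀)] [Fact (0 < c₁)]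
    (m : Fin d → ℕ) [∀ i, NeZero (m i)] (U : Bond d (towerP L m (n + 1)) → 𝔸ˣ) (αU : ℕ → ℝ) (hα1 : ∀ j, αU j ≤ 1 / 64)
    (hU1 : ∀ (j : ℕ) (x : B7Prop1Explicit.Site d) (κ : Fin d), perCfg (towerP L m (j + 1)) (UlevOf L m (n + 1) U j) x κ ∈ U1 𝔸)
    (hreg : ∀ (j : ℕ) (y : TSite d (towerP L m j)) (κ : Fin d) (r : Fin d → Fin L),
      ‖((Wcx L (perCfg (towerP L m (j + 1)) (UlevOf L m (n + 1) U j)) (cornerSite L y) κ (boxVec L r) : 𝔸ˣ) : 𝔸) - 1‖ ≤ αU j)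
    (hU : ∀ b, star (U b : 𝔸) = ((U b)⁻¹ : 𝔸ˣ)) (hτ₁ : ∀ X : 𝔸, τ (star X) = conj (τ X))
    (hτ₂ : ∀ X Y : 𝔸, τ (X * Y) = τ (Y * X)) (hφτ : ∀ X Y : 𝔸, ⟪φ.symm X, φ.symm Y⟫_ℂ = τ (star X * Y))
    {N : ℕ} (T : BondL2K ℂ d (towerP L m (n + 1)) c₀ W → EuclideanSpace ℝ (Fin N))
    (hT : ∀ x y, ⟪T x, T y⟫_ℝ = RCLike.re ⟪x, y⟫_ℂ) (hTs : Function.Surjective T)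
    (A' : EuclideanSpace ℝ (Fin N) → EuclideanSpace ℝ (Fin N))
    (hA' : ∀ x, A' (T x) = T (laplaceAk L m n φ η U hL αU hα1 hU1 hreg τ (c₀ := c₀) (c₁ := c₁) a x)) (v w : EuclideanSpace ℝ (Fin N)) :
    ⟪A' v, w⟫_ℝ = ⟪v, A' w⟫_ℝ :=
  inner_symm_chart_of_isSymmetric hT hTs hA' (laplaceAk_isSymmetric L m n φ η U hL αU hα1 hU1 hreg τ hU hτ₁ hτ₂ hφτ a) v w

/-! ## §3 (v1.1, appended) The CEILING `‖G_k(U)‖ ≤ γ₁⁻¹` ([B9] Thm 3.4's `L²` clause, NE9's theorem) in any chart -/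

section ChartNorm
variable {E : Type*} [NormedAddCommGroup E] [InnerProductSpace ℂ E] {F : Type*} [NormedAddCommGroup F] [InnerProductSpace ℝ F]
omit [NormedRing 𝔸] [NormedAlgebra ℂ 𝔸] [CompleteSpace 𝔸] [NormOneClass 𝔸] [StarRing 𝔸] [NormedStarGroup 𝔸] [StarModule ℂ 𝔸]
  [NormedAddCommGroup W] [InnerProductSpace ℂ W] [FiniteDimensional ℂ W] hMφ hMφ' hφ hφ' ha hr0 hr1 hτ hCτ hρw

/-- A chart preserves the norm: `‖T x‖ = ‖x‖`. [folklore] -/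
theorem norm_chart {T : E → F} (hT : ∀ x y, ⟪T x, T y⟫_ℝ = RCLike.re ⟪x, y⟫_ℂ) (x : E) : ‖T x‖ = ‖x‖ := by
  have h := norm_sq_chart hT x
  nlinarith [norm_nonneg (T x), norm_nonneg x, sq_nonneg (‖T x‖ - ‖x‖), sq_nonneg (‖T x‖ + ‖x‖)]

/-- **AN OPERATOR-NORM LETTER TRANSPORTS TO ANY CHART**: `‖A x‖ ≤ M‖x‖` for all `x`, `T` a chart onto `F`, `A′ (T x) = T (A x)` ⊢
`‖A′ v‖ ≤ M‖v‖` for all `v : F`. [folklore] -/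
theorem norm_map_chart_le {T : E → F} (hT : ∀ x y, ⟪T x, T y⟫_ℝ = RCLike.re ⟪x, y⟫_ℂ) (hTs : Function.Surjective T)
    {A : E → E} {A' : F → F} (hA' : ∀ x, A' (T x) = T (A x)) {M : ℝ} (hM : ∀ x, ‖A x‖ ≤ M * ‖x‖) (v : F) :
    ‖A' v‖ ≤ M * ‖v‖ := by
  obtain ⟨x, rfl⟩ := hTs v
  rw [hA', norm_chart hT, norm_chart hT]
  exact hM x
end ChartNorm

/-- **THE ROAD's COVARIANCE CEILING FOR `G_k(U) = (Δ^{(n+1)}_a(U))⁻¹`, BY NAME**: the binders of `exists_norm_G1k_le_diagonal_closed` VERBATIM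
(`B11Eq103H1Complex.G1LatticeK` at ANY positivity witness); `‖G_k(U)y‖ ≤ γ₁⁻¹‖y‖` read in ANY chart through ANY `G′` with `G′ ∘ T = T ∘ G_k(U)`:
`‖G′v‖ ≤ γ₁⁻¹‖v‖` — the road's `‖C‖ ≤ B₀` letter with `B₀ = γ₁⁻¹`, every small background. [junction; the estimate is NE9's theorem] -/
theorem norm_G1k_chart_le :
    ∃ α₀ γ₁ : ℝ, 0 < α₀ ∧ 0 < γ₁ ∧ ∀ (n : ℕ) (η : ℝ), η * (L : ℝ) ^ (n + 1) = 1 →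
      ∀ (c₀ c₁ : ℝ) [Fact (0 < c₀)] [Fact (0 < c₁)], c₀ * ((L : ℝ) ^ (n + 1)) ^ d = c₁ → |η| ^ d / c₀ ≤ ρw →
      ∀ (m : Fin d → ℕ) [∀ i, NeZero (m i)] (U : Bond d (towerP L m (n + 1)) → 𝔸ˣ) (αU : ℕ → ℝ) (hα1 : ∀ j, αU j ≤ 1 / 64)
        (hU1 : ∀ (j : ℕ) (x : B7Prop1Explicit.Site d) (κ : Fin d), perCfg (towerP L m (j + 1)) (UlevOf L m (n + 1) U j) x κ ∈ U1 𝔸)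
        (hreg : ∀ (j : ℕ) (y : TSite d (towerP L m j)) (κ : Fin d) (r : Fin d → Fin L),
          ‖((Wcx L (perCfg (towerP L m (j + 1)) (UlevOf L m (n + 1) U j)) (cornerSite L y) κ (boxVec L r) : 𝔸ˣ) : 𝔸) - 1‖ ≤ αU j)
        (εU : ℕ → ℝ), (∀ j, 0 ≤ εU j) → (∀ (j : ℕ) (b : Bond d (towerP L m (j + 1))), ‖(UlevOf L m (n + 1) U j b : 𝔸) - 1‖ ≤ εU j) →
      ∀ {α : ℝ}, 0 ≤ α → α ≤ α₀ →
        (∀ (b : Bond d (towerP L m (n + 1))) (v u : W), ⟪adTransportW φ U b v, u⟫_ℂ = ⟪v, adTransportW φ (fun b => (U b)⁻¹) b u⟫_ℂ) →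
        (∀ b, U b ∈ U1 𝔸) → (∀ b, ‖(U b : 𝔸) - 1‖ ≤ α * η) →
        (∀ p : B9SectCLatticeCarrier.Plaq d (towerP L m (n + 1)), ‖(plaqHolU U p : 𝔸) - 1‖ ≤ α * η ^ 2) →
        (∀ j < n + 1, εU j ≤ α * r ^ j) →
        ∀ (hpos : ∀ x : BondL2K ℂ d (towerP L m (n + 1)) c₀ W, x ≠ 0 →
            0 < RCLike.re ⟪x, laplaceAk L m n φ η U hL αU hα1 hU1 hreg τ (c₀ := c₀) (c₁ := c₁) a x⟫_ℂ)
          {N : ℕ} (T : BondL2K ℂ d (towerP L m (n + 1)) c₀ W → EuclideanSpace ℝ (Fin N)),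
          (∀ x y, ⟪T x, T y⟫_ℝ = RCLike.re ⟪x, y⟫_ℂ) → Function.Surjective T →
        ∀ (G' : EuclideanSpace ℝ (Fin N) → EuclideanSpace ℝ (Fin N)),
          (∀ y, G' (T y) = T (B11Eq103H1Complex.G1LatticeK hpos y)) →
        ∀ v : EuclideanSpace ℝ (Fin N), ‖G' v‖ ≤ γ₁⁻¹ * ‖v‖ := by
  obtain ⟨α₀, γ₁, hα₀, hγ₁, H⟩ := exists_norm_G1k_le_diagonal_closed L hL φ hMφ hMφ' hφ hφ' ha hr0 hr1 τ hτ hCτ hρw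
  refine ⟨α₀, γ₁, hα₀, hγ₁, ?_⟩
  intro n η hηL c₀ c₁ _ _ hw hρ m _ U αU hα1 hU1 hreg εU hεU hUε α hα0 hαle hRS hUb hUη hpl hεg hpos N T hT hTs G' hG' v
  exact norm_map_chart_le hT hTs hG'
    (fun y => H n η hηL c₀ c₁ hw hρ m U αU hα1 hU1 hreg εU hεU hUε hα0 hαle hRS hUb hUη hpl hεg hpos y) v

/-! ## §4 (v1.2, appended) RECTANGULAR chart transport for maps between two spaces (norms, matrix elements, adjoint pairs; charts exist) -/

section ChartPair
variable {E₁ : Type*} [NormedAddCommGroup E₁] [InnerProductSpace ℂ E₁] {E₂ : Type*} [NormedAddCommGroup E₂] [InnerProductSpace ℂ E₂]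
variable {F₁ : Type*} [NormedAddCommGroup F₁] [InnerProductSpace ℝ F₁] {F₂ : Type*} [NormedAddCommGroup F₂] [InnerProductSpace ℝ F₂]
omit [NormedRing 𝔸] [NormedAlgebra ℂ 𝔸] [CompleteSpace 𝔸] [NormOneClass 𝔸] [StarRing 𝔸] [NormedStarGroup 𝔸] [StarModule ℂ 𝔸]
  [NormedAddCommGroup W] [InnerProductSpace ℂ W] [FiniteDimensional ℂ W] hMφ hMφ' hφ hφ' ha hr0 hr1 hτ hCτ hρw

/-- **OPERATOR NORMS OF MAPS BETWEEN TWO SPACES TRANSPORT**: `‖B x‖ ≤ M‖x‖`, charts `T₁` (onto) and `T₂`, `B′ (T₁ x) = T₂ (B x)` ⊢ `‖B′ v‖ ≤ M‖v‖`.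
[folklore] -/
theorem norm_map_chart₂_le {T₁ : E₁ → F₁} (hT₁ : ∀ x y, ⟪T₁ x, T₁ y⟫_ℝ = RCLike.re ⟪x, y⟫_ℂ) (hT₁s : Function.Surjective T₁)
    {T₂ : E₂ → F₂} (hT₂ : ∀ x y, ⟪T₂ x, T₂ y⟫_ℝ = RCLike.re ⟪x, y⟫_ℂ)
    {B : E₁ → E₂} {B' : F₁ → F₂} (hB' : ∀ x, B' (T₁ x) = T₂ (B x)) {M : ℝ} (hM : ∀ x, ‖B x‖ ≤ M * ‖x‖) (v : F₁) :
    ‖B' v‖ ≤ M * ‖v‖ := by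
  obtain ⟨x, rfl⟩ := hT₁s v
  rw [hB', norm_chart hT₂, norm_chart hT₁]
  exact hM x

omit [NormedAddCommGroup E₁] [InnerProductSpace ℂ E₁] [NormedAddCommGroup F₁] [InnerProductSpace ℝ F₁] in
/-- **MATRIX ELEMENTS TRANSPORT**: `⟪B′ (T₁ x), T₂ y⟫_ℝ = re⟨B x, y⟩_ℂ` (`E₁`, `F₁` bare types here). [folklore] -/
theorem inner_map_chart₂ {E₁ F₁ : Type*} {T₁ : E₁ → F₁} {T₂ : E₂ → F₂} (hT₂ : ∀ x y, ⟪T₂ x, T₂ y⟫_ℝ = RCLike.re ⟪x, y⟫_ℂ)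
    {B : E₁ → E₂} {B' : F₁ → F₂} (hB' : ∀ x, B' (T₁ x) = T₂ (B x)) (x : E₁) (y : E₂) :
    ⟪B' (T₁ x), T₂ y⟫_ℝ = RCLike.re ⟪B x, y⟫_ℂ := by
  rw [hB', hT₂]

/-- **ADJOINT PAIRS TRANSPORT**: `⟨B x, y⟩_ℂ = ⟨x, B† y⟩_ℂ` for all `x, y`, charts `T₁, T₂` (both onto), `B′ ∘ T₁ = T₂ ∘ B`, `B†′ ∘ T₂ = T₁ ∘ B†` ⊢
`⟪B′ v, w⟫_ℝ = ⟪v, B†′ w⟫_ℝ` — print's adjoint pairs (`Q_k`, `Q_k*`; `D`, `D*`) stay adjoint pairs in the road's real charts. [folklore] -/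
theorem inner_adjoint_chart₂ {T₁ : E₁ → F₁} (hT₁ : ∀ x y, ⟪T₁ x, T₁ y⟫_ℝ = RCLike.re ⟪x, y⟫_ℂ) (hT₁s : Function.Surjective T₁)
    {T₂ : E₂ → F₂} (hT₂ : ∀ x y, ⟪T₂ x, T₂ y⟫_ℝ = RCLike.re ⟪x, y⟫_ℂ) (hT₂s : Function.Surjective T₂)
    {B : E₁ → E₂} {Badj : E₂ → E₁} (hadj : ∀ x y, ⟪B x, y⟫_ℂ = ⟪x, Badj y⟫_ℂ)
    {B' : F₁ → F₂} (hB' : ∀ x, B' (T₁ x) = T₂ (B x)) {Badj' : F₂ → F₁} (hBadj' : ∀ y, Badj' (T₂ y) = T₁ (Badj y))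
    (v : F₁) (w : F₂) : ⟪B' v, w⟫_ℝ = ⟪v, Badj' w⟫_ℝ := by
  obtain ⟨x, rfl⟩ := hT₁s v
  obtain ⟨y, rfl⟩ := hT₂s w
  rw [hB', hBadj', hT₂, hT₁, hadj]

/-- **CHARTS FOR A PAIR OF SPACES EXIST** (finite dimension): every `ℂ`-linear `B : E₁ →ₗ[ℂ] E₂` read by a continuous real-linear `B′`, every
`C : E₂ →ₗ[ℂ] E₁` by a `C′`. [folklore] -/
theorem exists_chart₂ [FiniteDimensional ℂ E₁] [FiniteDimensional ℂ E₂] :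
    ∃ (N₁ N₂ : ℕ) (T₁ : E₁ → EuclideanSpace ℝ (Fin N₁)) (T₂ : E₂ → EuclideanSpace ℝ (Fin N₂)),
    (∀ x y, ⟪T₁ x, T₁ y⟫_ℝ = RCLike.re ⟪x, y⟫_ℂ) ∧ Function.Surjective T₁ ∧
    (∀ x y, ⟪T₂ x, T₂ y⟫_ℝ = RCLike.re ⟪x, y⟫_ℂ) ∧ Function.Surjective T₂ ∧
    (∀ B : E₁ →ₗ[ℂ] E₂, ∃ B' : EuclideanSpace ℝ (Fin N₁) →L[ℝ] EuclideanSpace ℝ (Fin N₂), ∀ x, B' (T₁ x) = T₂ (B x)) ∧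
    (∀ C : E₂ →ₗ[ℂ] E₁, ∃ C' : EuclideanSpace ℝ (Fin N₂) →L[ℝ] EuclideanSpace ℝ (Fin N₁), ∀ y, C' (T₂ y) = T₁ (C y)) := by
  letI : InnerProductSpace ℝ E₁ := InnerProductSpace.complexToReal
  letI : InnerProductSpace ℝ E₂ := InnerProductSpace.complexToReal
  let b₁ := stdOrthonormalBasis ℝ E₁
  let b₂ := stdOrthonormalBasis ℝ E₂
  refine ⟨Module.finrank ℝ E₁, Module.finrank ℝ E₂, b₁.repr, b₂.repr, fun x y => ?_, b₁.repr.surjective, fun x y => ?_,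
    b₂.repr.surjective, fun B => ?_, fun C => ?_⟩
  · rw [b₁.repr.inner_map_map, real_inner_eq_re_inner]
  · rw [b₂.repr.inner_map_map, real_inner_eq_re_inner]
  · refine ⟨(b₂.repr.toContinuousLinearEquiv : E₂ →L[ℝ] EuclideanSpace ℝ (Fin (Module.finrank ℝ E₂))).comp
      ((B.restrictScalars ℝ).toContinuousLinearMap.comp
        (b₁.repr.symm.toContinuousLinearEquiv : EuclideanSpace ℝ (Fin (Module.finrank ℝ E₁)) →L[ℝ] E₁)), fun x => ?_⟩
    simp
  · refine ⟨(b₁.repr.toContinuousLinearEquiv : E₁ →L[ℝ] EuclideanSpace ℝ (Fin (Module.finrank ℝ E₁))).comp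
      ((C.restrictScalars ℝ).toContinuousLinearMap.comp
        (b₂.repr.symm.toContinuousLinearEquiv : EuclideanSpace ℝ (Fin (Module.finrank ℝ E₂)) →L[ℝ] E₂)), fun y => ?_⟩
    simp
end ChartPair

/-! ## §5 (v1.3, appended) The COVARIANCE letters of the inverse (`‖G‖ ≤ γ⁻¹`, `0 ≤ re⟨y,Gy⟩ ≤ γ⁻¹‖y‖²`), in any chart, and for `G_k(U)` -/

section Covariance
variable {E : Type*} [NormedAddCommGroup E] [InnerProductSpace ℂ E] {F : Type*} [NormedAddCommGroup F] [InnerProductSpace ℝ F]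
omit [NormedRing 𝔸] [NormedAlgebra ℂ 𝔸] [CompleteSpace 𝔸] [NormOneClass 𝔸] [StarRing 𝔸] [NormedStarGroup 𝔸] [StarModule ℂ 𝔸]
  [NormedAddCommGroup W] [InnerProductSpace ℂ W] [FiniteDimensional ℂ W] hMφ hMφ' hφ hφ' ha hr0 hr1 hτ hCτ hρw

/-- **FLOOR OF `A` + `A ∘ G = id` ⟹ THE COVARIANCE LETTERS OF `G`** (`γ > 0`): `γ‖Gy‖² ≤ re⟨Gy, y⟩`, `‖Gy‖ ≤ γ⁻¹‖y‖`,
`0 ≤ re⟨y, Gy⟩ ≤ γ⁻¹‖y‖²`. [folklore] -/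
theorem covariance_letters_of_re_inner {A G : E → E} (hAG : ∀ y, A (G y) = y) {γ : ℝ} (hγ0 : 0 < γ)
    (hγ : ∀ x, γ * ‖x‖ ^ 2 ≤ RCLike.re ⟪x, A x⟫_ℂ) (y : E) :
    γ * ‖G y‖ ^ 2 ≤ RCLike.re ⟪G y, y⟫_ℂ ∧ ‖G y‖ ≤ γ⁻¹ * ‖y‖ ∧
      0 ≤ RCLike.re ⟪y, G y⟫_ℂ ∧ RCLike.re ⟪y, G y⟫_ℂ ≤ γ⁻¹ * ‖y‖ ^ 2 := by
  have h1 : γ * ‖G y‖ ^ 2 ≤ RCLike.re ⟪G y, y⟫_ℂ := by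
    have h := hγ (G y)
    rwa [hAG] at h
  have hsymm : RCLike.re ⟪y, G y⟫_ℂ = RCLike.re ⟪G y, y⟫_ℂ := inner_re_symm _ _
  have hCS : RCLike.re ⟪G y, y⟫_ℂ ≤ ‖G y‖ * ‖y‖ := (RCLike.re_le_norm _).trans (norm_inner_le_norm _ _)
  have h2 : ‖G y‖ ≤ γ⁻¹ * ‖y‖ := by
    by_cases hG : ‖G y‖ = 0
    · rw [hG]; positivity
    · have hGpos : 0 < ‖G y‖ := lt_of_le_of_ne (norm_nonneg _) (Ne.symm hG)
      have h3 : γ * ‖G y‖ ≤ ‖y‖ := by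
        have h4 : (γ * ‖G y‖) * ‖G y‖ ≤ ‖y‖ * ‖G y‖ := by nlinarith [h1, hCS]
        exact le_of_mul_le_mul_right h4 hGpos
      calc ‖G y‖ = γ⁻¹ * (γ * ‖G y‖) := by field_simp
        _ ≤ γ⁻¹ * ‖y‖ := mul_le_mul_of_nonneg_left h3 (by positivity)
  refine ⟨h1, h2, ?_, ?_⟩
  · rw [hsymm]; nlinarith [h1, sq_nonneg ‖G y‖, hγ0.le]
  · rw [hsymm]
    calc RCLike.re ⟪G y, y⟫_ℂ ≤ ‖G y‖ * ‖y‖ := hCS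
      _ ≤ γ⁻¹ * ‖y‖ * ‖y‖ := mul_le_mul_of_nonneg_right h2 (norm_nonneg _)
      _ = γ⁻¹ * ‖y‖ ^ 2 := by ring

/-- **THE COVARIANCE LETTERS IN ANY CHART**: with `T` a chart onto `F` and `G′ (T y) = T (G y)`: `‖G′v‖ ≤ γ⁻¹‖v‖` and
`0 ≤ ⟪v, G′v⟫_ℝ ≤ γ⁻¹‖v‖²` — the road's two-sided covariance letters (`…CoerciveFluctuationFloor.inner_le_of_form_le`'s shape; the Gaussian files'
`0 ≤ C ≤ B₀`). [folklore] -/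
theorem covariance_letters_chart {T : E → F} (hT : ∀ x y, ⟪T x, T y⟫_ℝ = RCLike.re ⟪x, y⟫_ℂ) (hTs : Function.Surjective T)
    {A G : E → E} (hAG : ∀ y, A (G y) = y) {G' : F → F} (hG' : ∀ y, G' (T y) = T (G y)) {γ : ℝ} (hγ0 : 0 < γ)
    (hγ : ∀ x, γ * ‖x‖ ^ 2 ≤ RCLike.re ⟪x, A x⟫_ℂ) (v : F) :
    ‖G' v‖ ≤ γ⁻¹ * ‖v‖ ∧ 0 ≤ ⟪v, G' v⟫_ℝ ∧ ⟪v, G' v⟫_ℝ ≤ γ⁻¹ * ‖v‖ ^ 2 := by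
  obtain ⟨y, rfl⟩ := hTs v
  obtain ⟨-, h2, h3, h4⟩ := covariance_letters_of_re_inner hAG hγ0 hγ y
  rw [hG', norm_chart hT, norm_chart hT, hT]
  exact ⟨h2, h3, h4⟩
end Covariance

/-- **THE ROAD's COVARIANCE LETTERS FOR `G_k(U)` AT SMALL FIELDS, SAME `(α₀, γ₁)` AS THE FLOOR**: binders of `exists_coercive_laplaceAk_diagonal_closed`
VERBATIM; ANY positivity witness `hpos` (discharged at small fields by NE9's `exists_laplaceAk_pos_diagonal_closed`), ANY chart, ANY `G′` with
`G′ ∘ T = T ∘ G1LatticeK hpos` (`Δ ∘ G = id` by `laplaceALatticeK_G1LatticeK`): `‖G′v‖ ≤ γ₁⁻¹‖v‖`, `0 ≤ ⟪v, G′v⟫_ℝ ≤ γ₁⁻¹‖v‖²`. [junction] -/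
theorem covariance_G1k_chart :
    ∃ α₀ γ₁ : ℝ, 0 < α₀ ∧ 0 < γ₁ ∧ ∀ (n : ℕ) (η : ℝ), η * (L : ℝ) ^ (n + 1) = 1 →
      ∀ (c₀ c₁ : ℝ) [Fact (0 < c₀)] [Fact (0 < c₁)], c₀ * ((L : ℝ) ^ (n + 1)) ^ d = c₁ → |η| ^ d / c₀ ≤ ρw →
      ∀ (m : Fin d → ℕ) [∀ i, NeZero (m i)] (U : Bond d (towerP L m (n + 1)) → 𝔸ˣ) (αU : ℕ → ℝ) (hα1 : ∀ j, αU j ≤ 1 / 64)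
        (hU1 : ∀ (j : ℕ) (x : B7Prop1Explicit.Site d) (κ : Fin d), perCfg (towerP L m (j + 1)) (UlevOf L m (n + 1) U j) x κ ∈ U1 𝔸)
        (hreg : ∀ (j : ℕ) (y : TSite d (towerP L m j)) (κ : Fin d) (r : Fin d → Fin L),
          ‖((Wcx L (perCfg (towerP L m (j + 1)) (UlevOf L m (n + 1) U j)) (cornerSite L y) κ (boxVec L r) : 𝔸ˣ) : 𝔸) - 1‖ ≤ αU j)
        (εU : ℕ → ℝ), (∀ j, 0 ≤ εU j) → (∀ (j : ℕ) (b : Bond d (towerP L m (j + 1))), ‖(UlevOf L m (n + 1) U j b : 𝔸) - 1‖ ≤ εU j) →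
      ∀ {α : ℝ}, 0 ≤ α → α ≤ α₀ →
        (∀ (b : Bond d (towerP L m (n + 1))) (v u : W), ⟪adTransportW φ U b v, u⟫_ℂ = ⟪v, adTransportW φ (fun b => (U b)⁻¹) b u⟫_ℂ) →
        (∀ b, U b ∈ U1 𝔸) → (∀ b, ‖(U b : 𝔸) - 1‖ ≤ α * η) →
        (∀ p : B9SectCLatticeCarrier.Plaq d (towerP L m (n + 1)), ‖(plaqHolU U p : 𝔸) - 1‖ ≤ α * η ^ 2) →
        (∀ j < n + 1, εU j ≤ α * r ^ j) →
        ∀ (hpos : ∀ x : BondL2K ℂ d (towerP L m (n + 1)) c₀ W, x ≠ 0 →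
            0 < RCLike.re ⟪x, laplaceAk L m n φ η U hL αU hα1 hU1 hreg τ (c₀ := c₀) (c₁ := c₁) a x⟫_ℂ)
          {N : ℕ} (T : BondL2K ℂ d (towerP L m (n + 1)) c₀ W → EuclideanSpace ℝ (Fin N)),
          (∀ x y, ⟪T x, T y⟫_ℝ = RCLike.re ⟪x, y⟫_ℂ) → Function.Surjective T →
        ∀ (G' : EuclideanSpace ℝ (Fin N) → EuclideanSpace ℝ (Fin N)),
          (∀ y, G' (T y) = T (B11Eq103H1Complex.G1LatticeK hpos y)) →
        ∀ v : EuclideanSpace ℝ (Fin N), ‖G' v‖ ≤ γ₁⁻¹ * ‖v‖ ∧ 0 ≤ ⟪v, G' v⟫_ℝ ∧ ⟪v, G' v⟫_ℝ ≤ γ₁⁻¹ * ‖v‖ ^ 2 := by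
  obtain ⟨α₀, γ₁, hα₀, hγ₁, H⟩ := exists_coercive_laplaceAk_diagonal_closed L hL φ hMφ hMφ' hφ hφ' ha hr0 hr1 τ hτ hCτ hρw
  refine ⟨α₀, γ₁, hα₀, hγ₁, ?_⟩
  intro n η hηL c₀ c₁ _ _ hw hρ m _ U αU hα1 hU1 hreg εU hεU hUε α hα0 hαle hRS hUb hUη hpl hεg hpos N T hT hTs G' hG' v
  have hAG : ∀ y, laplaceAk L m n φ η U hL αU hα1 hU1 hreg τ (c₀ := c₀) (c₁ := c₁) a (B11Eq103H1Complex.G1LatticeK hpos y) = y :=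
    fun y => by rw [laplaceAk, B11Eq103H1Complex.laplaceALatticeK_G1LatticeK]
  exact covariance_letters_chart hT hTs hAG hG' hγ₁
    (fun x => H n η hηL c₀ c₁ hw hρ m U αU hα1 hU1 hreg εU hεU hUε hα0 hαle hRS hUb hUη hpl hεg x) v

end Summit.QuantumFields.BalabanUV.T4Continuum.NE7b.BackgroundFibreFloor
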